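import Summits.Ventures.PercRepro.ProfilePointedCircuitClassesStarSharpD0A
import Summits.Ventures.PercRepro.ProfilePointedCircuitClassesStarSharpD0B

/-!
# PercRepro — CASE D0 OF `StarNineSharp`, PART C: THE «NO ON LINE, NO ON PLANE THROUGH `e, f`» REGIME IS PROVED
(p5, gen 54; `proofs/P5-GM1.md` §81 (c), rules R2 / R3 assembled)

Hypotheses (on `N`: `#E = 9`, `ρ = 5`, a series pair `{b, b′}`, `e ≠ f` outside it): no line of `R = N ∖ {b, b′}`
is ON (`hnl`), `e` is simple on `X = E₇ − e − f` (`he1`), `ρ(X) = 4` (`hX`), and every rank-`3` subset of `E₇`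
through `e` and `f` is OFF (`hef`).  Every ON demand `W = π + e + b` then has `ρ(π + e + f) = 4`
(`rk_insert_f_eq_four_of_no_ef_plane`), hence `X ∖ π ∈ A`, and is sent to the bi-basis `π + e + f` when `X ∖ π` is OFF
(R2) and to `{e, f, x} + b` for the point `x` of D0B's `r3_point_exists` when `X ∖ π` is ON (R3; injective by
`r3_injective`).  Together with D0A's OFF injection this proves **`inCount_thru_le_of_no_on_line_no_ef`** — the
sub-regime of D0 with 46,018 + 66,589 of its 191,842 catalogue configurations (§81 (c)).
-/

open scoped Matroid

namespace PercRepro.Cogirth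

open Finset ThmH Skew Shadow Profile

variable {α : Type} [DecidableEq α] {N : Matroid α} [N.Finite]

section StarSharpD0C

variable {b b' : α}

/-- If `f` adds no rank to `S` then it adds no rank to `S ∪ T` (submodularity). -/
theorem rk_insert_union_eq_of_rk_insert_eq {S T : Finset α} {f : α} (hS : rk N (insert f S) = rk N S) :
    rk N (insert f (S ∪ T)) = rk N (S ∪ T) := by
  have h1 := rk_union_add_rk_le_of_subset_inter' (N := N) (S := insert f S) (T := S ∪ T) (I := S)
    (by intro x hx; exact mem_inter.2 ⟨mem_insert_of_mem hx, mem_union_left _ hx⟩)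
  have e1 : insert f S ∪ (S ∪ T) = insert f (S ∪ T) := by ext x; simp only [mem_union, mem_insert]; tauto
  rw [e1, hS] at h1
  have h2 : rk N (S ∪ T) ≤ rk N (insert f (S ∪ T)) := rk_mono' (M := N) (subset_insert _ _)
  omega

/-- **NO ON PLANE THROUGH `e, f` ⟹ `ρ(π + e + f) = 4` FOR EVERY ON DEMAND**: if `Y ⊆ E₇` has `ρ(Y) = 3`, is ON and
`ρ(insert f Y) = 3`, then `insert f Y` is a rank-`3` set through `f` that is ON — excluded by `hef` when `e ∈ Y`. -/
theorem rk_insert_f_eq_four_of_no_ef_plane {e f : α} (hf : f ∈ gr N) (hfb : f ≠ b)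
    (hfb' : f ≠ b')
    (hef : ∀ Y : Finset α, Y ⊆ ((gr N).erase b).erase b' → e ∈ Y → f ∈ Y → rk N Y = 3 →
      rk N (insert b (insert b' Y)) = 5)
    {Y : Finset α} (hY : Y ⊆ ((gr N).erase b).erase b') (heY : e ∈ Y) (hY3 : Y.card = 3) (hYr : rk N Y = 3)
    (hYon : rk N (insert b (insert b' Y)) = 4) : rk N (insert f Y) = 4 := by
  have hfE : f ∈ ((gr N).erase b).erase b' := mem_erase.2 ⟨hfb', mem_erase.2 ⟨hfb, hf⟩⟩
  have hfY : f ∉ Y := by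
    intro hfY
    have : rk N (insert f Y) = 3 := by rw [insert_eq_of_mem hfY]; exact hYr
    have h5 := hef Y hY heY hfY hYr
    omega
  have hle : rk N (insert f Y) ≤ 4 := by
    have := rk_le_card' (M := N) (insert f Y)
    rw [card_insert_of_notMem hfY, hY3] at this; exact this
  have hge : rk N Y ≤ rk N (insert f Y) := rk_mono' (M := N) (subset_insert _ _)
  by_contra hne
  have h3 : rk N (insert f Y) = 3 := by omega
  have hon' : rk N (insert b (insert b' (insert f Y))) = 4 := by
    have e1 : insert b (insert b' (insert f Y)) = insert f (Y ∪ {b, b'}) := by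
      ext x; simp only [mem_insert, mem_union, mem_singleton]; tauto
    have e2 : insert b (insert b' Y) = Y ∪ {b, b'} := by
      ext x; simp only [mem_insert, mem_union, mem_singleton]; tauto
    rw [e1, rk_insert_union_eq_of_rk_insert_eq (by rw [h3, hYr]), ← e2, hYon]
  have h5 := hef (insert f Y) (insert_subset hfE hY) (mem_insert_of_mem heY) (mem_insert_self _ _) h3
  omega

/-- The R3 point of an ON demand `W`, chosen classically (`e` if there is none). -/
noncomputable def r3Point (N : Matroid α) [N.Finite] (b b' e f : α) (W : Finset α) : α :=
  open Classical in
  if h : ∃ x ∈ (W.erase b).erase e, rk N {e, f, x} = 3 ∧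
      rk N ((((((gr N).erase b).erase b').erase f).erase e).erase x) = 4 ∧
      rk N (insert b (insert b' {e, f, x})) = 5 then h.choose else e

/-- The R2 / R3 map on the ON demands: `π + e + f` when `X ∖ π` is OFF, else `{e, f, x} + b`. -/
noncomputable def r23Map (N : Matroid α) [N.Finite] (b b' e f : α) (W : Finset α) : Finset α :=
  if rk N (insert b (insert b' (((((gr N).erase b).erase b').erase f).erase e \ (W.erase b).erase e))) = 5 then
    insert f (W.erase b) else insert b {e, f, r3Point N b b' e f W}

/-- **THE NO-ON-LINE, NO-`ef`-PLANE REGIME OF `StarNineSharp`**: with no ON line, `e` simple on `X`, `ρ(X) = 4` and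
no ON rank-`3` set through `e, f`, the `b′`-avoiding two-point inequality holds. -/
theorem inCount_thru_le_of_no_on_line_no_ef (hn : (gr N).card = 9) (hR : rk N (gr N) = 5) (h : SeriesPair N b b')
    {e f : α} (he : e ∈ gr N) (hf : f ∈ gr N) (hef : e ≠ f) (heb : e ≠ b) (heb' : e ≠ b') (hfb : f ≠ b) (hfb' : f ≠ b')
    (hnl : ∀ S : Finset α, S ⊆ ((gr N).erase b).erase b' → rk N (insert b (insert b' S)) ≤ 3 → rk N S ≤ 1)
    (he1 : ∀ y ∈ ((((gr N).erase b).erase b').erase f).erase e, rk N {e, y} = 2)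
    (hX : rk N (((((gr N).erase b).erase b').erase f).erase e) = 4)
    (hefp : ∀ Y : Finset α, Y ⊆ ((gr N).erase b).erase b' → e ∈ Y → f ∈ Y → rk N Y = 3 →
      rk N (insert b (insert b' Y)) = 5) :
    inCount N 4 e + thruCount N 4 {b', f} + thruCount N 4 {b', e, f} ≤
      inCount N 4 f + thruCount N 4 {e, f} + thruCount N 4 {b', e} := by
  rw [inCount_thru_split']
  have hb : b ∈ gr N := h.1; have hb' : b' ∈ gr N := h.2.1; have hbb' : b ≠ b' := h.2.2.1
  have hXE : ((((gr N).erase b).erase b').erase f).erase e ⊆ ((gr N).erase b).erase b' := (erase_subset _ _).trans (erase_subset _ _)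
  have heE : e ∈ ((gr N).erase b).erase b' := mem_erase.2 ⟨heb', mem_erase.2 ⟨heb, he⟩⟩
  have hfE : f ∈ ((gr N).erase b).erase b' := mem_erase.2 ⟨hfb', mem_erase.2 ⟨hfb, hf⟩⟩
  have hE7c : (((gr N).erase b).erase b').card = 7 := by
    rw [card_erase_of_mem (mem_erase.2 ⟨hbb'.symm, hb'⟩), card_erase_of_mem hb, hn]
  have hsplit := card_filter_add_card_filter_not (s := (biIndepSets N 4).filter (fun W => (e ∈ W ∧ f ∉ W) ∧ b' ∉ W))
    (fun W => (gr N \ W).erase b' ∈ biIndepSets N 4)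
  simp only [filter_filter] at hsplit
  -- the three target kinds
  have htar : ((biIndepSets N 4).filter (fun W => (f ∈ W ∧ b' ∉ W) ∧ (e ∉ W ∧ (gr N \ W).erase b' ∈ biIndepSets N 4))).card +
      ((biIndepSets N 4).filter (fun W => (f ∈ W ∧ b' ∉ W) ∧ (e ∈ W ∧ b ∉ W))).card +
      ((biIndepSets N 4).filter (fun W => (f ∈ W ∧ b' ∉ W) ∧ (e ∈ W ∧ b ∈ W))).card ≤
      ((biIndepSets N 4).filter (fun W => f ∈ W ∧ b' ∉ W)).card := by
    rw [← card_union_of_disjoint, ← card_union_of_disjoint]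
    · apply card_le_card
      intro W hW
      simp only [mem_union, mem_filter] at hW ⊢
      rcases hW with (hW | hW) | hW <;> exact ⟨hW.1, hW.2.1⟩
    · rw [disjoint_union_left]
      constructor
      · rw [disjoint_filter]
        rintro W _ ⟨-, heW, -⟩ ⟨-, heW', -⟩
        exact heW heW'
      · rw [disjoint_filter]
        rintro W _ ⟨-, -, hbW⟩ ⟨-, -, hbW'⟩
        exact hbW hbW'
    · rw [disjoint_filter]
      rintro W _ ⟨-, heW, -⟩ ⟨-, heW', -⟩
      exact heW heW'
  have hinj1 := card_off_demands_le (N := N) (b' := b') (e := e) hf hfb'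
  -- the data of an ON demand, in the form the map needs
  have hdata : ∀ W ∈ biIndepSets N 4, ((e ∈ W ∧ f ∉ W) ∧ b' ∉ W) → ¬ (gr N \ W).erase b' ∈ biIndepSets N 4 →
      b ∈ W ∧ (W.erase b).erase e ⊆ ((((gr N).erase b).erase b').erase f).erase e ∧ ((W.erase b).erase e).card = 2 ∧ insert e ((W.erase b).erase e) = W.erase b ∧
        insert b (W.erase b) = W ∧ rk N (insert e ((W.erase b).erase e)) = 3 ∧
        rk N (insert f (((((gr N).erase b).erase b').erase f).erase e \ (W.erase b).erase e)) = 4 ∧ rk N (insert b (insert b' (insert e ((W.erase b).erase e)))) = 4 ∧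
        rk N (insert f (insert e ((W.erase b).erase e))) = 4 := by
    intro W hWs hPD hcW
    obtain ⟨hbW, hYE, heY, hfY, hY3, hYr, hYc, hYon⟩ := demand_on_data h hn heb hWs hPD hcW
    have hπX : (W.erase b).erase e ⊆ ((((gr N).erase b).erase b').erase f).erase e := by
      intro x hx
      rw [mem_erase] at hx
      exact mem_erase.2 ⟨hx.1, mem_erase.2 ⟨fun h' => hfY (h' ▸ hx.2), hYE hx.2⟩⟩
    have hπ2 : ((W.erase b).erase e).card = 2 := by rw [card_erase_of_mem heY, hY3]
    have hYeq : insert e ((W.erase b).erase e) = W.erase b := insert_erase heY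
    have hf4 := rk_insert_f_eq_four_of_no_ef_plane hf hfb hfb' hefp hYE heY hY3 hYr hYon
    refine ⟨hbW, hπX, hπ2, hYeq, insert_erase hbW, by rw [hYeq]; exact hYr, ?_, by rw [hYeq]; exact hYon,
      by rw [hYeq]; exact hf4⟩
    rw [← E7_sdiff_insert_e_eq hf hef hfb hfb' hπX, hYeq]
    exact hYc
  have hinj2 : ((biIndepSets N 4).filter (fun W => ((e ∈ W ∧ f ∉ W) ∧ b' ∉ W) ∧
        ¬ (gr N \ W).erase b' ∈ biIndepSets N 4)).card ≤
      ((biIndepSets N 4).filter (fun W => (f ∈ W ∧ b' ∉ W) ∧ (e ∈ W ∧ b ∉ W))).card +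
      ((biIndepSets N 4).filter (fun W => (f ∈ W ∧ b' ∉ W) ∧ (e ∈ W ∧ b ∈ W))).card := by
    rw [← card_union_of_disjoint (by rw [disjoint_filter]; rintro W _ ⟨-, -, hbW⟩ ⟨-, -, hbW'⟩; exact hbW hbW')]
    apply card_le_card_of_injOn (r23Map N b b' e f)
    · intro W hW
      simp only [mem_coe, mem_filter] at hW
      obtain ⟨hWs, hPD, hcW⟩ := hW
      obtain ⟨hbW, hπX, hπ2, hYeq, hWeq, hYr, hYc, hYon, hf4⟩ := hdata W hWs hPD hcW
      have hfπ : f ∉ (W.erase b).erase e := fun h' => hPD.1.2 (mem_of_mem_erase (mem_of_mem_erase h'))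
      have heπ : e ∉ (W.erase b).erase e := fun h' => (mem_erase.1 h').1 rfl
      have hb'π : b' ∉ (W.erase b).erase e := fun h' => hPD.2 (mem_of_mem_erase (mem_of_mem_erase h'))
      have hbπ : b ∉ (W.erase b).erase e := fun h' => (mem_erase.1 (mem_of_mem_erase h')).1 rfl
      have hXπ : ((((gr N).erase b).erase b').erase f).erase e \ (W.erase b).erase e ⊆ ((gr N).erase b).erase b' := sdiff_subset.trans hXE
      have hcon := rk_insert_bb'_bounds h hXπ
      have hS3 : rk N (((((gr N).erase b).erase b').erase f).erase e \ (W.erase b).erase e) = 3 := by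
        have hXc : (((((gr N).erase b).erase b').erase f).erase e).card = 5 := by
          rw [card_erase_of_mem (mem_erase.2 ⟨hef, heE⟩), card_erase_of_mem hfE, hE7c]
        have hSc : (((((gr N).erase b).erase b').erase f).erase e \ (W.erase b).erase e).card = 3 := by rw [card_sdiff_of_subset hπX, hXc, hπ2]
        have hc : (insert f (((((gr N).erase b).erase b').erase f).erase e \ (W.erase b).erase e)).card = 4 := by
          rw [card_insert_of_notMem (fun h' => (mem_erase.1 (mem_erase.1 (mem_sdiff.1 h').1).2).1 rfl), hSc]
        rw [rk_eq_card_of_subset_of_rk_eq_card (M := N) (subset_insert f _) (by rw [hYc, hc]), hSc]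
      simp only [mem_coe, mem_union, mem_filter, r23Map]
      split_ifs with hoff
      · -- R2: the bi-basis `π + e + f`
        left
        have hWE : insert f (W.erase b) ⊆ ((gr N).erase b).erase b' := by
          rw [← hYeq]; exact insert_subset hfE (insert_subset heE (hπX.trans hXE))
        have hW4 : (insert f (W.erase b)).card = 4 := by
          rw [← hYeq, card_insert_of_notMem, card_insert_of_notMem heπ, hπ2]
          simp only [mem_insert, not_or]; exact ⟨hef.symm, hfπ⟩
        refine ⟨?_, ⟨mem_insert_self _ _, ?_⟩, mem_insert_of_mem (mem_erase.2 ⟨heb, hPD.1.1⟩), ?_⟩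
        · rw [mem_biIndepSets_iff_of_subset_E7 h hn hWE hW4, ← hYeq, E7_sdiff_insert_ef_eq]
          exact ⟨hf4, hoff⟩
        · intro h'
          rcases mem_insert.1 h' with h2 | h2
          · exact hfb' h2.symm
          · exact hPD.2 (mem_of_mem_erase h2)
        · intro h'
          rcases mem_insert.1 h' with h2 | h2
          · exact hfb h2.symm
          · exact (mem_erase.1 h2).1 rfl
      · -- R3: the point `x` of D0B
        right
        have hcon4 : rk N (insert b (insert b' (((((gr N).erase b).erase b').erase f).erase e \ (W.erase b).erase e))) = 4 := by omega
        obtain ⟨x, hxπ, hefx, hx4, hx5⟩ := r3_point_exists h hn hR hnl he hf hef heb heb' hfb hfb' he1 hX hπX hπ2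
          hYc hYon hf4 hcon4
        have hex : ∃ x ∈ (W.erase b).erase e, rk N {e, f, x} = 3 ∧ rk N ((((((gr N).erase b).erase b').erase f).erase e).erase x) = 4 ∧
            rk N (insert b (insert b' {e, f, x})) = 5 := ⟨x, hxπ, hefx, hx4, hx5⟩
        have hpt : r3Point N b b' e f W = hex.choose := by
          simp only [r3Point]
          rw [dif_pos hex]
        obtain ⟨hxπ', hefx', hx4', -⟩ := hex.choose_spec
        rw [hpt]
        set z := hex.choose with hz
        have hzX : z ∈ ((((gr N).erase b).erase b').erase f).erase e := hπX hxπ'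
        have hzE : z ∈ ((gr N).erase b).erase b' := hXE hzX
        have hze : z ≠ e := fun h' => (mem_erase.1 hzX).1 h'
        have hzf : z ≠ f := fun h' => (mem_erase.1 (mem_erase.1 hzX).2).1 h'
        have hS : ({e, f, z} : Finset α) ⊆ ((gr N).erase b).erase b' := by
          intro w hw; simp only [mem_insert, mem_singleton] at hw
          rcases hw with rfl | rfl | rfl <;> assumption
        have hS3' : ({e, f, z} : Finset α).card = 3 := by
          rw [card_insert_of_notMem, card_pair hzf.symm]
          simp only [mem_insert, mem_singleton, not_or]; exact ⟨hef, hze.symm⟩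
        refine ⟨?_, ⟨mem_insert_of_mem (mem_insert_of_mem (mem_insert_self _ _)), ?_⟩,
          mem_insert_of_mem (mem_insert_self _ _), mem_insert_self _ _⟩
        · rw [insert_b_mem_biIndepSets_iff h hn hS hS3', E7_sdiff_efx_eq]
          exact ⟨hefx', hx4'⟩
        · intro h'
          simp only [mem_insert, mem_singleton] at h'
          rcases h' with h2 | h2 | h2 | h2
          · exact hbb' h2.symm
          · exact heb' h2.symm
          · exact hfb' h2.symm
          · exact (mem_erase.1 hzE).1 h2.symm
    · intro W₁ hW₁ W₂ hW₂ heq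
      simp only [mem_coe, mem_filter] at hW₁ hW₂
      obtain ⟨hb₁, hπ₁, hπ2₁, hYeq₁, hWeq₁, -, hYc₁, hYon₁, hf4₁⟩ := hdata W₁ hW₁.1 hW₁.2.1 hW₁.2.2
      obtain ⟨hb₂, hπ₂, hπ2₂, hYeq₂, hWeq₂, -, hYc₂, hYon₂, hf4₂⟩ := hdata W₂ hW₂.1 hW₂.2.1 hW₂.2.2
      have hf₁ : f ∉ W₁.erase b := fun h' => hW₁.2.1.1.2 (mem_of_mem_erase h')
      have hf₂ : f ∉ W₂.erase b := fun h' => hW₂.2.1.1.2 (mem_of_mem_erase h')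
      have hbY : ∀ Y : Finset α, b ∉ insert f (Y.erase b) := fun Y h' =>
        (mem_insert.1 h').elim (fun h2 => hfb h2.symm) (fun h2 => (mem_erase.1 h2).1 rfl)
      simp only [r23Map] at heq
      split_ifs at heq with h₁ h₂ h₂
      · have e2 : W₁.erase b = W₂.erase b := by
          rw [← erase_insert hf₁, ← erase_insert hf₂, heq]
        rw [← insert_erase hb₁, ← insert_erase hb₂, e2]
      · exact absurd (heq ▸ mem_insert_self b _) (hbY _)
      · exact absurd (heq.symm ▸ mem_insert_self b _) (hbY _)
      · -- both R3: the points coincide, then `r3_injective`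
        have hXπ₁ : ((((gr N).erase b).erase b').erase f).erase e \ (W₁.erase b).erase e ⊆ ((gr N).erase b).erase b' := sdiff_subset.trans hXE
        have hXπ₂ : ((((gr N).erase b).erase b').erase f).erase e \ (W₂.erase b).erase e ⊆ ((gr N).erase b).erase b' := sdiff_subset.trans hXE
        have hcon₁ : rk N (insert b (insert b' (((((gr N).erase b).erase b').erase f).erase e \ (W₁.erase b).erase e))) = 4 := by
          have := rk_insert_bb'_bounds h hXπ₁
          have hS3 : rk N (((((gr N).erase b).erase b').erase f).erase e \ (W₁.erase b).erase e) = 3 := by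
            have hXc : (((((gr N).erase b).erase b').erase f).erase e).card = 5 := by
              rw [card_erase_of_mem (mem_erase.2 ⟨hef, heE⟩), card_erase_of_mem hfE, hE7c]
            have hSc : (((((gr N).erase b).erase b').erase f).erase e \ (W₁.erase b).erase e).card = 3 := by rw [card_sdiff_of_subset hπ₁, hXc, hπ2₁]
            have hc : (insert f (((((gr N).erase b).erase b').erase f).erase e \ (W₁.erase b).erase e)).card = 4 := by
              rw [card_insert_of_notMem (fun h' => (mem_erase.1 (mem_erase.1 (mem_sdiff.1 h').1).2).1 rfl), hSc]
            rw [rk_eq_card_of_subset_of_rk_eq_card (M := N) (subset_insert f _) (by rw [hYc₁, hc]), hSc]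
          omega
        have hcon₂ : rk N (insert b (insert b' (((((gr N).erase b).erase b').erase f).erase e \ (W₂.erase b).erase e))) = 4 := by
          have := rk_insert_bb'_bounds h hXπ₂
          have hS3 : rk N (((((gr N).erase b).erase b').erase f).erase e \ (W₂.erase b).erase e) = 3 := by
            have hXc : (((((gr N).erase b).erase b').erase f).erase e).card = 5 := by
              rw [card_erase_of_mem (mem_erase.2 ⟨hef, heE⟩), card_erase_of_mem hfE, hE7c]
            have hSc : (((((gr N).erase b).erase b').erase f).erase e \ (W₂.erase b).erase e).card = 3 := by rw [card_sdiff_of_subset hπ₂, hXc, hπ2₂]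
            have hc : (insert f (((((gr N).erase b).erase b').erase f).erase e \ (W₂.erase b).erase e)).card = 4 := by
              rw [card_insert_of_notMem (fun h' => (mem_erase.1 (mem_erase.1 (mem_sdiff.1 h').1).2).1 rfl), hSc]
            rw [rk_eq_card_of_subset_of_rk_eq_card (M := N) (subset_insert f _) (by rw [hYc₂, hc]), hSc]
          omega
        obtain ⟨x₁, hx₁, hefx₁, hx4₁, hx5₁⟩ := r3_point_exists h hn hR hnl he hf hef heb heb' hfb hfb' he1 hX hπ₁ hπ2₁
          hYc₁ hYon₁ hf4₁ hcon₁
        obtain ⟨x₂, hx₂, hefx₂, hx4₂, hx5₂⟩ := r3_point_exists h hn hR hnl he hf hef heb heb' hfb hfb' he1 hX hπ₂ hπ2₂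
          hYc₂ hYon₂ hf4₂ hcon₂
        have hex₁ : ∃ x ∈ (W₁.erase b).erase e, rk N {e, f, x} = 3 ∧ rk N ((((((gr N).erase b).erase b').erase f).erase e).erase x) = 4 ∧
            rk N (insert b (insert b' {e, f, x})) = 5 := ⟨x₁, hx₁, hefx₁, hx4₁, hx5₁⟩
        have hex₂ : ∃ x ∈ (W₂.erase b).erase e, rk N {e, f, x} = 3 ∧ rk N ((((((gr N).erase b).erase b').erase f).erase e).erase x) = 4 ∧
            rk N (insert b (insert b' {e, f, x})) = 5 := ⟨x₂, hx₂, hefx₂, hx4₂, hx5₂⟩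
        have hpt₁ : r3Point N b b' e f W₁ = hex₁.choose := by simp only [r3Point]; rw [dif_pos hex₁]
        have hpt₂ : r3Point N b b' e f W₂ = hex₂.choose := by simp only [r3Point]; rw [dif_pos hex₂]
        rw [hpt₁, hpt₂] at heq
        obtain ⟨hz₁, -, hz4₁, -⟩ := hex₁.choose_spec
        obtain ⟨hz₂, -, hz4₂, -⟩ := hex₂.choose_spec
        set z₁ := hex₁.choose with hz₁def
        set z₂ := hex₂.choose with hz₂def
        have hz₁X : z₁ ∈ ((((gr N).erase b).erase b').erase f).erase e := hπ₁ hz₁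
        have hz₂X : z₂ ∈ ((((gr N).erase b).erase b').erase f).erase e := hπ₂ hz₂
        have hz₁e : z₁ ≠ e := fun h' => (mem_erase.1 hz₁X).1 h'
        have hz₁f : z₁ ≠ f := fun h' => (mem_erase.1 (mem_erase.1 hz₁X).2).1 h'
        have hz₁b : z₁ ≠ b := fun h' => (mem_erase.1 (mem_erase.1 (hXE hz₁X)).2).1 h'
        have hzz : z₁ = z₂ := by
          have : z₁ ∈ insert b ({e, f, z₂} : Finset α) := by
            rw [← heq]; exact mem_insert_of_mem (mem_insert_of_mem (mem_insert_of_mem (mem_singleton_self _)))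
          simp only [mem_insert, mem_singleton] at this
          rcases this with h' | h' | h' | h'
          · exact absurd h' hz₁b
          · exact absurd h' hz₁e
          · exact absurd h' hz₁f
          · exact h'
        -- `π₁ = {z, y₁}`, `π₂ = {z, y₂}`
        by_cases hππ : (W₁.erase b).erase e = (W₂.erase b).erase e
        · have e2 : W₁.erase b = W₂.erase b := by rw [← hYeq₁, ← hYeq₂, hππ]
          rw [← insert_erase hb₁, ← insert_erase hb₂, e2]
        · exfalso
          have hc₁ : (((W₁.erase b).erase e).erase z₁).card = 1 := by rw [card_erase_of_mem hz₁, hπ2₁]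
          have hc₂ : (((W₂.erase b).erase e).erase z₂).card = 1 := by rw [card_erase_of_mem hz₂, hπ2₂]
          obtain ⟨y₁, hy₁⟩ := card_eq_one.1 hc₁
          obtain ⟨y₂, hy₂⟩ := card_eq_one.1 hc₂
          have eπ₁ : (W₁.erase b).erase e = {z₁, y₁} := by
            rw [← insert_erase hz₁, hy₁]
          have eπ₂ : (W₂.erase b).erase e = {z₂, y₂} := by
            rw [← insert_erase hz₂, hy₂]
          have hy₁X : y₁ ∈ ((((gr N).erase b).erase b').erase f).erase e := hπ₁ (by rw [eπ₁]; exact mem_insert_of_mem (mem_singleton_self _))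
          have hy₂X : y₂ ∈ ((((gr N).erase b).erase b').erase f).erase e := hπ₂ (by rw [eπ₂]; exact mem_insert_of_mem (mem_singleton_self _))
          have hyy : y₁ ≠ y₂ := by
            intro hyy
            apply hππ
            rw [eπ₁, eπ₂, hzz, hyy]
          rw [eπ₁] at hcon₁
          rw [eπ₂, ← hzz] at hcon₂
          exact r3_injective h hR hnl hyy hy₁X hy₂X hcon₁ hcon₂ hz4₁
  omega

end StarSharpD0C

end PercRepro.Cogirth
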